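import Literature.MathematicalPhysics.QuantumFieldTheory.Balaban1983to89.B9DirSupHolderAtPins
import Literature.MathematicalPhysics.QuantumFieldTheory.Balaban1983to89.B9CoReadingCoordsHolderSNear

/-!
# `Balaban1983to89.B9DirSupHolderAtPinsSN` — T. Bałaban, *Propagators for lattice gauge theories in a background field*, Commun. Math. Phys. **99** (1985) 389–434
# [Balaban1985BackgroundPropagators], (3.43) p. 398 with (3.39)–(3.40) p. 397: the kinematic schema `DirSupHolder37` («a Hölder probe majorant of `Φ_β∘∇_U∘G′` gives the same
# majorant of every directional member `Φ_β∘∇_{U,ν}∘G′`») AT THE SITE PINS WITH THE NEAR PROBE CARRIER `holderProbesSN`, for an ARBITRARY background class record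

[4] = T. Bałaban, *Propagators and renormalization transformations for lattice gauge theories. II*, Commun. Math. Phys. **96** (1984) 223–250 [`Balaban1984PropagatorsII`].
statement-level skeleton of published theorems with citation tags; proofs where landed; nothing here is a claim about the Yang–Mills mass gap.

WHY THIS FILE (cell `pub-ymgap`, node N06 [B9], seat `pub-ymgap-dag-n06-c` g19).  The N06 certificate's rows-18 kinematics (`Summits/…/BalabanUVNodesN06DirKinematicsAtPins(R).lean`,
`dirSupHolder37_pinsSA`) are typed at the CUT carrier `holderProbesSA` and at the background `bg9Y` (the `R`-class edition transports through `opsRY`).  The re-pin of the site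
probe family to the NEAR carrier `holderProbesSN` (this lineage's `B9CoReadingCoordsHolderSNear`, the carrier on which the rows-20–21 Hölder binder `hpDGW` is assembled,
`B9HpDGWFromPinsSN`) needs the same schema at the new pin; dag-n06-w5's carrier-generic `B9DirSupHolderAtPins.dirSupHolder37_of_pins` gives it in three lines, and stating it for an
ARBITRARY `B : B9.Backgrounds` with `cfg : B.Cfg → CfgY 𝔸 i` serves `bg9Y`, `bg9YP` and `bg9YR … R₁ R₂` alike (no transport).
* ★ `dirSupHolder37_of_pinsSN` — index level; ★ `dirSupHolder37_pinsSN` — member level (`Ops (geo9Y x) B …`, the certificate's typing).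
HONEST SCOPE.  Kinematics only (probe bookkeeping, no estimate); COUNT-NEUTRAL; N06 NOT discharged; nothing continuum, nothing about the mass gap.  Cell `pub-ymgap` (HUMAN RULING
D-0062), Track A node N06 [B9], seat `pub-ymgap-dag-n06-c` (g19), 2026-08-29; a NEW file; 0 `def`, no `sorry`, no `axiom`, no `instance`, no `notation`.
-/

noncomputable section

namespace Literature.MathematicalPhysics.QuantumFieldTheory.Balaban1983to89.B9DirSupHolderAtPinsSN

open B6KLevelCensusIndexV1 (KIdx)
open B9Thm37Whole (Ops)
open B9RWSums346SecondDiffGp (DirOps37)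
open B9RWSums343Holder (HolderProbes)
open B9RWSums344InputPair (DirSupHolder37)
open B9GeoNormsKLevelV1 (geo9K)
open B9PinMembersKLevelV1 (MemberY geo9Y)
open B9CoReadingCoords (coordOpK)
open B9CoReadingCoordsS (XSK blkSK sIK GcoS DcoS)
open B9CoReadingCoordsHolder (PK)
open B9CoReadingCoordsHolderSNear (holderProbesSN wSN)
open B9Ineq349SiteComposite (cdSL)
open B9DirSupHolderAtPins (dirSupHolder37_of_pins)
open Node00 (SiteY FBondY IBondY CfgY SiteOpY SiteParY etaS)

variable {d ℓ : ℕ} {hd : 1 ≤ d + 1} {hL : Odd (ℓ + 1) ∧ 1 < ℓ + 1} {b₀ b₁ : ℝ}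
variable {𝔸 : Type} [NormedRing 𝔸] [NormedAlgebra ℂ 𝔸] [CompleteSpace 𝔸] [FiniteDimensional ℝ 𝔸]
variable {κ : Type} [Fintype κ]

/-- ★ **`DirSupHolder37 𝔬 𝔡 𝔭 R H U` AT THE SITE PINS WITH THE NEAR PROBE CARRIER `holderProbesSN`** (dag-n06-w5's carrier-generic `dirSupHolder37_of_pins` at `g = par (cfg U)`,
`w = wSN β`, `w₀ = 1`, anchors `blkPK (sIK bI)`), any background class record `B`. [cite: Balaban1985BackgroundPropagators, (3.43) p.398 + (3.39)–(3.40) p.397; Balaban1984PropagatorsII, (2.51) p.232] -/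
theorem dirSupHolder37_of_pinsSN (i : KIdx d ℓ hd hL b₀ b₁) (b : Module.Basis κ ℝ 𝔸) (B : B9.Backgrounds) (cfg : B.Cfg → CfgY 𝔸 i) [Fintype (geo9K i).Site]
    {ι : Type} (O : SiteOpY 𝔸 i) (𝔬 : Ops (geo9K i) B (XSK κ i) (XSK κ i) ι) (𝔡 : DirOps37 𝔬 (Fin (d + 1)))
    (𝔭 : HolderProbes (geo9K i) B (XSK κ i) (XSK κ i) (PK (SiteY i) (Fin (d + 1)) κ) (PK (SiteY i) (Fin (d + 1)) κ))
    {bI : FBondY i → IBondY i} (par : SiteParY 𝔸 i)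
    (h𝔭 : 𝔭 = holderProbesSN i b B cfg par bI) (hblk : 𝔬.blk = blkSK i (sIK i bI)) {U₁ : B.Cfg}
    (hGp : 𝔬.Gp U₁ = GcoS i b B cfg O U₁) (hD : 𝔬.D U₁ = DcoS i b B cfg U₁)
    (hDd : 𝔡.Dd U₁ = fun μ => (etaS i)⁻¹ • coordOpK b (fun _ : Fin (d + 1) => (cdSL i (cfg U₁) μ).restrictScalars ℝ))
    {R : ℝ} {H : Prop} : DirSupHolder37 𝔬 𝔡 𝔭 R H U₁ := by
  subst h𝔭
  exact dirSupHolder37_of_pins i b B cfg O 𝔬 𝔡 _ (fun U z z' => par (cfg U) z z') (fun β => wSN i β) (fun _ _ => (1 : ℝ)) hblk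
    (fun _ => rfl) (fun _ => rfl) rfl rfl hGp hD hDd

variable {Mstar : ℕ} [∀ x : MemberY d ℓ hd hL b₀ b₁ Mstar, Fintype (geo9Y x).Site]

/-- ★ **THE SAME AT A MEMBER, IN THE CERTIFICATE's TYPING** (`𝔬 : Ops (geo9Y x) B …`, pins `h𝔭 ∕ hblkS ∕ hGpS ∕ hDS ∕ h𝔡d` verbatim with the near carrier; `B` arbitrary, e.g.
`bg9YR 𝔸 G R₁ R₂ x` with `cfg := fun U => U`). [cite: Balaban1985BackgroundPropagators, (3.43) p.398 + (3.39)–(3.40) p.397; Balaban1984PropagatorsII, (2.51) p.232] -/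
theorem dirSupHolder37_pinsSN (x : MemberY d ℓ hd hL b₀ b₁ Mstar) (b : Module.Basis κ ℝ 𝔸) (B : B9.Backgrounds) (cfg : B.Cfg → CfgY 𝔸 x.toKIdx)
    {ι : Type} (O : SiteOpY 𝔸 x.toKIdx) (𝔬 : Ops (geo9Y x) B (XSK κ x.toKIdx) (XSK κ x.toKIdx) ι) (𝔡 : DirOps37 𝔬 (Fin (d + 1)))
    (𝔭 : HolderProbes (geo9Y x) B (XSK κ x.toKIdx) (XSK κ x.toKIdx) (PK (SiteY x.toKIdx) (Fin (d + 1)) κ) (PK (SiteY x.toKIdx) (Fin (d + 1)) κ))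
    {bI : FBondY x.toKIdx → IBondY x.toKIdx} (par : SiteParY 𝔸 x.toKIdx)
    (h𝔭 : 𝔭 = holderProbesSN x.toKIdx b B cfg par bI) (hblkS : 𝔬.blk = blkSK x.toKIdx (sIK x.toKIdx bI)) {U : B.Cfg}
    (hGpS : 𝔬.Gp U = GcoS x.toKIdx b B cfg O U) (hDS : 𝔬.D U = DcoS x.toKIdx b B cfg U)
    (h𝔡d : 𝔡.Dd U = fun μ => (etaS x.toKIdx)⁻¹ • coordOpK b (fun _ : Fin (d + 1) => (cdSL x.toKIdx (cfg U) μ).restrictScalars ℝ))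
    {R : ℝ} {H : Prop} : DirSupHolder37 𝔬 𝔡 𝔭 R H U := by
  letI : Fintype (geo9K x.toKIdx).Site := (inferInstance : Fintype (geo9Y x).Site)
  exact dirSupHolder37_of_pinsSN x.toKIdx b B cfg O 𝔬 𝔡 𝔭 par h𝔭 hblkS hGpS hDS h𝔡d

end Literature.MathematicalPhysics.QuantumFieldTheory.Balaban1983to89.B9DirSupHolderAtPinsSN

end
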